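import Summits.BirchSwinnertonDyer.BirchSwinnertonDyer.Theses.ByReductionTypeAtTwo
import Summits.BirchSwinnertonDyer.BirchSwinnertonDyer.Theorems.ByReductionTypeAtTwoKatoHalfPinch
import Summits.BirchSwinnertonDyer.BirchSwinnertonDyer.Theorems.ByReductionTypeAtTwoGoodOrdinaryPub
import Summits.BirchSwinnertonDyer.BirchSwinnertonDyer.Theorems.ByReductionTypeAtTwoOrdHalvesDefs
import Literature.Uncategorized.OrdPublishedInputsAtTwo
import HarnessLib

/-!
# Route `ByReductionTypeAtTwo` (rung K4), split children of `GoodOrdinaryRankZeroAtTwo`: the REVERSE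
# glue — `OrdPublishedInputsAtTwo → OrdKatoHalfAtTwo → GoodOrdinaryRankZeroAtTwo ⇒` the `2`-adic main
# conjecture and the Eisenstein half on the whole rank-`0` good-ordinary class (seat bsd-2adic-ord-2)

HONEST FRAMING (cell `bsd-2adic`, run/shared/lean/pub/bsd-2adic/, HUMAN RULINGS D-0036/D-0074):
THEOREMS ONLY about the route's decls; nothing asserted;
(the two split children are named through their CARRIER constants
`Literature.Uncategorized.OrdPublishedInputsAtTwo` / `Theorems.OrdHalvesAtTwo.OrdKatoHalfAtTwo`, of which the route
decls `…Theses.ByReductionTypeAtTwo.OrdPublishedInputsAtTwo / .OrdKatoHalfAtTwo` are `def`initional aliases since rev 9 —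
so every statement below applies to the route decls by unfolding;) no definition; no named fact; closes no item.
The landed glue item `GoodOrdinaryRankZeroAtTwoOfChildren` (stmt-BirchSwinnertonDyer-19152) reads
`OrdPublishedInputsAtTwo → OrdKatoHalfAtTwo → OrdEisensteinHalfAtTwo → GoodOrdinaryRankZeroAtTwo`
(bridge `goodOrdinaryRankZeroAtTwo_of_facts_of_halves`, p409439). This file records the converse
direction that the integral constant-term pinch (`Theorems/ByReductionTypeAtTwoKatoHalfPinch.lean`)
makes available: GIVEN the Kato half (item stmt-BirchSwinnertonDyer-19150), the parent crux
`GoodOrdinaryRankZeroAtTwo` (= `BSD(E,2)` on the class) already implies the FULL `2`-adic cyclotomic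
main conjecture `MazurMainConjecture W 2` — hence the Eisenstein half
`X5.O1.MainConjectureEisensteinDivisibilityAtTwo W` — at EVERY non-CM, analytic-rank-`0`,
good-ordinary-at-`2` curve, with no `λ`-certificate, no Néron-integrality certificate, no Prop-5.14
point and no isogeny transport. So, modulo the four PUBLISHED inputs and the Kato half, the parent
crux and the rank-`0` part of the shared child `OrdEisensteinHalfAtTwo` (stmt-…-19151) are
EQUIVALENT (`goodOrdinaryRankZeroAtTwo_iff_eisenstein_rankZero_of_ordKatoHalfAtTwo`): on the rank-`0`
good-ordinary block the Kato half is the ENTIRE Iwasawa-theoretic content beyond `BSD(·,2)` itself, and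
every class where `BSD(·,2)` is known numerically and the Kato half is proved carries the `2`-adic IMC.

PARTITION (D-0054): X5@2 good-ord (B1·O1; 611 book230 classes, 83 CLOSED (literal, R254) + 528 open)
× p = 2 — types-the-object-of; closes none. References: [Kato2004Asterisque] Thm. 17.4;
[GreenbergLNM1716] Thm. 4.1; [SkinnerUrban2014] Conj. 3.6.8 (p odd; shape); [Miller2011LMS] Def. 1.1.
-/

set_option autoImplicit false

noncomputable section

open scoped Classical MatrixGroups ModularForm

open CongruenceSubgroup WeierstrassCurve Literature.NumberTheory.EllipticCurves
  Literature.NumberTheory.EllipticCurves.ModularForms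
  Literature.NumberTheory.EllipticCurves.Rank1Residual
  Literature.NumberTheory.EllipticCurves.Rank1Residual.Typed
  Summit.BirchSwinnertonDyer.BirchSwinnertonDyer.Theorems.Rank1ResidualX1Defs
  Summit.BirchSwinnertonDyer.Rank1Residual.X5

namespace Summit.BirchSwinnertonDyer.BirchSwinnertonDyer.Theorems.KatoHalfPinch

open Summit.BirchSwinnertonDyer.BirchSwinnertonDyer.Theses.ByReductionTypeAtTwo

/-- **Reverse glue, main-conjecture form.** The support child `OrdPublishedInputsAtTwo` (modularity,
GZK, Kato 17.4 (1)(2)@2, Greenberg Thm. 4.1 parity-free), the crux child `OrdKatoHalfAtTwo` and the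
parent crux `GoodOrdinaryRankZeroAtTwo` (`BSD(E,2)` on the class) give the `2`-adic cyclotomic main
conjecture `MazurMainConjecture W 2` at every non-CM, analytic-rank-`0`, good-ordinary-at-`2` curve
(`KatoHalfPinch.mazurMainConjecture_two_of_facts_of_katoHalfAt_of_bsdp`, per curve).
[cite: Kato2004Asterisque, Thm. 17.4 (1) (p. 273)] [cite: GreenbergLNM1716, Thm. 4.1 (p. 102)] -/
theorem mazurMainConjecture_two_of_ordKatoHalfAtTwo_of_goodOrdinaryRankZeroAtTwo
    (hPub : Literature.Uncategorized.OrdPublishedInputsAtTwo)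
    (hK : Summit.BirchSwinnertonDyer.BirchSwinnertonDyer.Theorems.OrdHalvesAtTwo.OrdKatoHalfAtTwo) (hG : GoodOrdinaryRankZeroAtTwo)
    (W : WeierstrassCurve ℚ) [W.IsElliptic] [W.IsGloballyMinimal] (hcm : ¬ W.HasCM)
    (hr : W.analyticRank = 0) (hgo : GoodOrd W 2) : MazurMainConjecture W 2 := by
  obtain ⟨hmod, hGZK, h17, hGr⟩ := hPub
  exact mazurMainConjecture_two_of_facts_of_katoHalfAt_of_bsdp W hmod hGZK (fun f => h17 W f) hGr hgo
    hr (hG W hcm hr hgo) (hK W hcm hr hgo)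

/-- **Reverse glue, Eisenstein form.** Under `OrdPublishedInputsAtTwo` and `OrdKatoHalfAtTwo`, the parent
crux `GoodOrdinaryRankZeroAtTwo` implies the RANK-`0` part of the shared child `OrdEisensteinHalfAtTwo`:
the Eisenstein (lower) half `X5.O1.MainConjectureEisensteinDivisibilityAtTwo W` at every non-CM,
analytic-rank-`0`, good-ordinary-at-`2` curve. [cite: Kato2004Asterisque, Thm. 17.4 (1) (p. 273)]
[cite: GreenbergLNM1716, Thm. 4.1 (p. 102)] [cite: SkinnerUrban2014, Conj. 3.6.8 (p. 45) (shape)] -/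
theorem eisenstein_rankZero_of_ordKatoHalfAtTwo_of_goodOrdinaryRankZeroAtTwo
    (hPub : Literature.Uncategorized.OrdPublishedInputsAtTwo)
    (hK : Summit.BirchSwinnertonDyer.BirchSwinnertonDyer.Theorems.OrdHalvesAtTwo.OrdKatoHalfAtTwo) (hG : GoodOrdinaryRankZeroAtTwo)
    (W : WeierstrassCurve ℚ) [W.IsElliptic] [W.IsGloballyMinimal] (hcm : ¬ W.HasCM)
    (hr : W.analyticRank = 0) (hgo : GoodOrd W 2) :
    O1.MainConjectureEisensteinDivisibilityAtTwo W :=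
  O1.mainConjectureEisensteinDivisibilityAtTwo_of_mazurMainConjecture W
    (fun _ => mazurMainConjecture_two_of_ordKatoHalfAtTwo_of_goodOrdinaryRankZeroAtTwo hPub hK hG W hcm
      hr hgo)

/-- **The equivalence.** Given the PUBLISHED inputs and the Kato half, the parent crux
`GoodOrdinaryRankZeroAtTwo` holds IFF the Eisenstein half holds at every non-CM, analytic-rank-`0`,
good-ordinary-at-`2` curve (⇐: the landed glue `goodOrdinaryRankZeroAtTwo_of_facts_of_halves`, p409439;
⇒: the reverse glue above). [cite: Kato2004Asterisque, Thm. 17.4 (1)(2) (p. 273)]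
[cite: GreenbergLNM1716, Thm. 4.1 (p. 102)] [cite: Miller2011LMS, Def. 1.1] -/
theorem goodOrdinaryRankZeroAtTwo_iff_eisenstein_rankZero_of_ordKatoHalfAtTwo
    (hPub : Literature.Uncategorized.OrdPublishedInputsAtTwo)
    (hK : Summit.BirchSwinnertonDyer.BirchSwinnertonDyer.Theorems.OrdHalvesAtTwo.OrdKatoHalfAtTwo) :
    GoodOrdinaryRankZeroAtTwo ↔
      ∀ (W : WeierstrassCurve ℚ) [W.IsElliptic] [W.IsGloballyMinimal],
        ¬ W.HasCM → W.analyticRank = 0 → GoodOrd W 2 →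
          O1.MainConjectureEisensteinDivisibilityAtTwo W := by
  refine ⟨fun hG W _ _ hcm hr hgo =>
    eisenstein_rankZero_of_ordKatoHalfAtTwo_of_goodOrdinaryRankZeroAtTwo hPub hK hG W hcm hr hgo,
    fun hE => ?_⟩
  obtain ⟨hmod, hGZK, h17, hGr⟩ := hPub
  exact goodOrdinaryRankZeroAtTwo_of_facts_of_halves hmod hGZK h17 hGr
    (fun W _ _ hcm hr hgo => hK W hcm hr hgo) hE

/-- **The equivalence, main-conjecture form.** Given the PUBLISHED inputs and the Kato half, the parent
crux `GoodOrdinaryRankZeroAtTwo` holds IFF the `2`-adic cyclotomic main conjecture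
`MazurMainConjecture W 2` holds at every non-CM, analytic-rank-`0`, good-ordinary-at-`2` curve (⇐: the
landed one-child bridge `goodOrdinaryRankZeroAtTwo_of_facts_of_mazurMainConjecture`, p409439).
[cite: Kato2004Asterisque, Thm. 17.4 (1)(2) (p. 273)] [cite: GreenbergLNM1716, Thm. 4.1 (p. 102)] -/
theorem goodOrdinaryRankZeroAtTwo_iff_mazurMainConjecture_of_ordKatoHalfAtTwo
    (hPub : Literature.Uncategorized.OrdPublishedInputsAtTwo)
    (hK : Summit.BirchSwinnertonDyer.BirchSwinnertonDyer.Theorems.OrdHalvesAtTwo.OrdKatoHalfAtTwo) :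
    GoodOrdinaryRankZeroAtTwo ↔
      ∀ (W : WeierstrassCurve ℚ) [W.IsElliptic] [W.IsGloballyMinimal],
        ¬ W.HasCM → W.analyticRank = 0 → GoodOrd W 2 → MazurMainConjecture W 2 := by
  refine ⟨fun hG W _ _ hcm hr hgo =>
    mazurMainConjecture_two_of_ordKatoHalfAtTwo_of_goodOrdinaryRankZeroAtTwo hPub hK hG W hcm hr hgo,
    fun hMC => ?_⟩
  obtain ⟨hmod, hGZK, h17, hGr⟩ := hPub
  exact goodOrdinaryRankZeroAtTwo_of_facts_of_mazurMainConjecture hmod hGZK h17 hGr hMC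

end Summit.BirchSwinnertonDyer.BirchSwinnertonDyer.Theorems.KatoHalfPinch

end
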